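import Mathlib
import HarnessLib
import Literature.MathematicalPhysics.QuantumFieldTheory.Sweep1
import Literature.MathematicalPhysics.QuantumFieldTheory.Sweep1Proofs
import Literature.MathematicalPhysics.QuantumFieldTheory.StrongCouplingTorusLimit
import Literature.MathematicalPhysics.QuantumFieldTheory.PlaqSystemClustering
import Literature.MathematicalPhysics.QuantumFieldTheory.UniformTorusClusteringProofs

/-!
# `CurvatureKernelBound` — brick `InfiniteVolumeCurvatureClustering` of lead c10's swap-mirror programme toward `Stub.FiniteCouplingStrongSubextensive`
# (crux stmt-QuantumFields-11687, line `coupling-trichotomy`, skeleton v9)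

For a bounded measurable LOCAL observable `Q` of the `ℤ⁴`-gauge configurations and couplings
`0 ≤ β ≤ β' < betaOne 4 ρ / 4` (strong coupling) the registered theorem
`InfiniteVolumeCurvatureClustering` packages three facts about the free-boundary infinite-volume
state `ω_β = lim_L ⟨·⟩_{box 4 L, β}`:

1. EXISTENCE of the box limits `q β` of `⟨Q ∘ τ_x⟩` and `P β (y − x)` of `⟨(Q ∘ τ_x)(Q ∘ τ_y)⟩`;
2. TRANSLATION INVARIANCE (the limit of a translate is the limit of the observable, so `q` does
   not depend on `x` and `P` only on `y − x`);
3. β-UNIFORM EXPONENTIAL CLUSTERING `|P β z − q β ^ 2| ≤ A e^{−m ‖z‖_∞}` with ONE mass `m > 0` and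
   ONE constant `A` for all `β ∈ [0, β']` and all `z`.

## Proof

(1)+(2) are Osterwalder–Seiler 1978 Thms. 3.6–3.7 as proved in the tree
(`exists_differentiableOn_tendsto_expect`: convergence of the complex-coupling expectations along
the directed set of all finite regions on the disc `‖β‖ < betaOne/4`; `zdExpect_eq` identifies the
free-boundary expectations of `Sweep1` with their real parts; `expect_comp_translate` and the
cofinality of translated boxes `tendsto_box_image_add_atTop` give the translates), rendered here
with the explicit radius `betaOne d ρ / 4` (`hasBoxLimit_zdExpect_of_dependsOn`; the named fact
`osterwalderSeiler_infiniteVolume` hides the radius behind `∃ β₀`).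

(3) is the free-boundary analogue of the tree's torus theorems `StrongCouplingClusteringDisc(Explicit)`
(same namespace): the abstract replica-expansion bound `PlaqSystem.norm_truncatedExpect_le`
(`‖⟨F₁F₂⟩_V − ⟨F₁⟩_V⟨F₂⟩_V‖ ≤ K (‖β‖/r)^n` for complex `‖β‖ ≤ r < β_R`) applied to the FREE system
`zdSystem ρ` (whose expectations on `V = plaquettesIn Λ` are definitionally `expect ρ · Λ`, and
`β_R = betaOne`), with the level function `p ↦ ‖p.1‖_∞` on plaquette labels of `ℤ^d`: it is
`1`-Lipschitz along adjacency, `≤ R + 1` on labels touching the support `S` of `Q` (`R` its bond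
radius) and `≥ ‖z‖_∞ − R − 1` on labels touching the support of `Q ∘ τ_z`, so every joining polymer
has at least `‖z‖_∞ − (2R + 2)` labels (`PlaqSystem.le_card_of_joins`) — no wrap-around, so this is
simpler than the torus count. With `r = betaOne/2`, `m = log (r/β')` one has
`(‖β‖/r)^n ≤ (β'/r)^n = e^{−m n}` for all `|β| ≤ β'`; near displacements use the crude bound
`PlaqSystem.norm_truncatedExpect_le_const`. The finite-volume bound is uniform in the region `Λ`,
hence passes to the box limit (`le_of_tendsto'`). Everything used is proved in the tree; no named
facts. Reference: K. Osterwalder, E. Seiler, Ann. Phys. 110 (1978) 440–471, Thms. 3.5–3.7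
[OsterwalderSeilerAnnPhys1978]. [folklore]
-/

noncomputable section

open scoped BigOperators Topology
open MeasureTheory Filter
open Literature.MathematicalPhysics.QuantumFieldTheory Literature.Probability.LatticeModels
open Literature.Probability.LatticeModels.Site (supNorm supNorm_le_iff natAbs_le_supNorm
  exists_natAbs_eq_supNorm norm_eq_supNorm)

namespace Summit.QuantumFields.YangMills.Theorems.CurvatureKernel

/-! ### Geometry of supports and their translates in `ℤ^d` -/

/-- The level `p ↦ ‖p.1‖_∞` on plaquette labels grows by at most one along adjacency. [folklore] -/
theorem supNorm_fst_le_of_plaqAdj {d : ℕ} {u v : Plaq d} (h : Plaq.Adj u v) :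
    supNorm v.1 ≤ supNorm u.1 + 1 := by
  refine supNorm_le_iff.2 fun k => ?_
  have h1 := Plaq.natAbs_sub_le_one_of_adj h k
  have h2 := natAbs_le_supNorm u.1 k
  omega

/-- Labels touching a bond set `B` have level at most `bondRadius B + 1`. [folklore] -/
theorem supNorm_fst_le_of_touches {d : ℕ} {B : Finset (ZdEdge d)} {p : Plaq d}
    (h : Plaq.Touches B p) : supNorm p.1 ≤ bondRadius B + 1 :=
  supNorm_le_iff.2 fun k => natAbs_le_of_touches h k

/-- Labels touching the support `{(e.1 + z, e.2) : e ∈ S}` of `Q ∘ τ_z` (written with `e.1 - -z`)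
have level at least `‖z‖_∞ − bondRadius S − 1`. [folklore] -/
theorem le_supNorm_fst_of_touches_translate {d : ℕ} [NeZero d] {S : Finset (ZdEdge d)}
    {z : Site d} {q : Plaq d} (h : Plaq.Touches (S.image fun e => (e.1 - -z, e.2)) q) :
    supNorm z - bondRadius S - 1 ≤ supNorm q.1 := by
  obtain ⟨k, hk⟩ := exists_natAbs_eq_supNorm Finset.univ_nonempty z
  have h1 := natAbs_add_le_of_touches_shift h k
  have h2 := natAbs_le_supNorm q.1 k
  simp only [Pi.neg_apply] at h1
  omega

/-- A support of bond radius `R` and its translate by `z` are disjoint once `2R < ‖z‖_∞`. [folklore] -/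
theorem disjoint_image_translate_of_lt {d : ℕ} [NeZero d] {S : Finset (ZdEdge d)} {z : Site d}
    (hfar : 2 * bondRadius S < supNorm z) :
    Disjoint S (S.image fun e => (e.1 - -z, e.2)) := by
  rw [Finset.disjoint_left]
  rintro e he he'
  obtain ⟨f, hf, hfe⟩ := Finset.mem_image.1 he'
  obtain ⟨k, hk⟩ := exists_natAbs_eq_supNorm Finset.univ_nonempty z
  have h1 := (supNorm_le_iff.1 (supNorm_le_bondRadius he)) k
  have h2 := (supNorm_le_iff.1 (supNorm_le_bondRadius hf)) k
  have h3 : f.1 k + z k = e.1 k := by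
    have := congr_arg (fun e : ZdEdge d => e.1 k) hfe
    simpa [sub_neg_eq_add] using this
  omega

/-- **Joining polymers of the free system are long**: a polymer of `ℤ^d`-plaquette labels joining
the support `S` (bond radius `R`) to its translate by `z` has at least `‖z‖_∞ − (2R + 2)` labels
(`PlaqSystem.le_card_of_joins` with the level `‖·‖_∞` of base points; no wrap-around). [folklore] -/
theorem le_card_of_joins_translate {d N : ℕ} [NeZero d] {G : Type*} [Group G]
    (ρ : G →* Matrix (Fin N) (Fin N) ℂ) {S : Finset (ZdEdge d)} {z : Site d} {P : Finset (Plaq d)}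
    (hJ : (zdSystem (G := G) ρ).Joins P S (S.image fun e => (e.1 - -z, e.2))) :
    supNorm z - (2 * bondRadius S + 2) ≤ P.card := by
  have h := PlaqSystem.le_card_of_joins (S := zdSystem (G := G) ρ) (fun p : Plaq d => supNorm p.1)
    (fun _ _ huv => supNorm_fst_le_of_plaqAdj huv) (a := bondRadius S + 1)
    (b := supNorm z - bondRadius S - 1) (fun _ hp => supNorm_fst_le_of_touches hp)
    (fun _ hq => le_supNorm_fst_of_touches_translate hq) hJ
  omega

/-- The number of labels of the free system touching `B` is at most `|B| · 2^d d²`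
(the seeds of `zdSystem ρ` are definitionally `Plaq.seedsOf`). [folklore] -/
theorem card_seedsOf_zdSystem_le {d N : ℕ} {G : Type*} [Group G]
    (ρ : G →* Matrix (Fin N) (Fin N) ℂ) (B : Finset (ZdEdge d)) :
    ((zdSystem (G := G) ρ).seedsOf B).card ≤ B.card * (2 ^ d * (d * d)) :=
  card_seedsOf_le_mul B

/-! ### Finite-volume truncated correlations of the free-boundary states -/

/-- **The free-boundary truncated correlation as a truncated expectation of the free plaquette
system** (real bounded measurable `F₁, F₂`, real coupling):
`|⟨F₁F₂⟩_{Λ,β} − ⟨F₁⟩_{Λ,β}⟨F₂⟩_{Λ,β}| ≤ ‖⟨Φ₁Φ₂⟩_Λ(β) − ⟨Φ₁⟩_Λ(β)⟨Φ₂⟩_Λ(β)‖` for the complexified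
observables `Φᵢ = (Fᵢ : ℂ)` (`zdExpect_eq` + reality of the complex expectations). [folklore] -/
theorem abs_zdExpect_truncated_le_norm {d N : ℕ} {G : Type*} [Group G] [TopologicalSpace G]
    [IsTopologicalGroup G] [CompactSpace G] [MeasurableSpace G] [BorelSpace G]
    {ρ : G →* Matrix (Fin N) (Fin N) ℂ} (hρ : Continuous ρ) (β : ℝ) (Λ : Finset (Site d))
    {F₁ F₂ : ZdGaugeConfig d G → ℝ} (h₁m : Measurable F₁) (h₂m : Measurable F₂) {C₁ C₂ : ℝ}
    (hC₁ : ∀ U, |F₁ U| ≤ C₁) (hC₂ : ∀ U, |F₂ U| ≤ C₂) :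
    |zdExpect ρ β Λ (fun U => F₁ U * F₂ U) - zdExpect ρ β Λ F₁ * zdExpect ρ β Λ F₂| ≤
      ‖(zdSystem ρ).expect (fun U => (F₁ U : ℂ) * (F₂ U : ℂ)) (plaquettesIn Λ) β -
        (zdSystem ρ).expect (fun U => (F₁ U : ℂ)) (plaquettesIn Λ) β *
          (zdSystem ρ).expect (fun U => (F₂ U : ℂ)) (plaquettesIn Λ) β‖ := by
  have hC₁0 : 0 ≤ C₁ := (abs_nonneg _).trans (hC₁ fun _ => 1)
  have h12m : Measurable fun U => F₁ U * F₂ U := h₁m.mul h₂m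
  have h12b : ∀ U, |F₁ U * F₂ U| ≤ C₁ * C₂ := fun U => by
    rw [abs_mul]; exact mul_le_mul (hC₁ _) (hC₂ _) (abs_nonneg _) hC₁0
  rw [zdExpect_eq hρ β Λ h12m h12b, zdExpect_eq hρ β Λ h₁m hC₁, zdExpect_eq hρ β Λ h₂m hC₂]
  have hprod : (fun U : ZdGaugeConfig d G => (((F₁ U * F₂ U : ℝ)) : ℂ)) =
      fun U => (F₁ U : ℂ) * (F₂ U : ℂ) := by
    funext U; push_cast; rfl
  rw [hprod]
  exact abs_re_sub_mul_re_le (PlaqSystem.expect_ofReal_im (S := zdSystem ρ) F₁ (plaquettesIn Λ) β)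
    (PlaqSystem.expect_ofReal_im (S := zdSystem ρ) F₂ (plaquettesIn Λ) β)

/-- **β-uniform finite-volume clustering of the free-boundary states at strong coupling.** For a
bounded measurable observable `Q` supported on `S` and `0 < β' < r < betaOne d ρ` there is ONE
constant `A = A(Q, β', r)` such that for every real coupling `|β| ≤ β'`, every finite region `Λ`
and every displacement `z`,
`|⟨Q · (Q ∘ τ_z)⟩_{Λ,β} − ⟨Q⟩_{Λ,β} ⟨Q ∘ τ_z⟩_{Λ,β}| ≤ A e^{−log (r/β') ‖z‖_∞}`
(replica expansion of the free plaquette system `zdSystem ρ` + Schwarz lemma,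
`PlaqSystem.norm_truncatedExpect_le`; free-boundary analogue of `StrongCouplingClusteringDiscExplicit`).
[folklore] -/
theorem zdExpect_truncated_le_uniform {d N : ℕ} [NeZero d] {G : Type*} [Group G]
    [TopologicalSpace G] [IsTopologicalGroup G] [CompactSpace G] [MeasurableSpace G] [BorelSpace G]
    {ρ : G →* Matrix (Fin N) (Fin N) ℂ} (hρ : Continuous ρ) {Q : ZdGaugeConfig d G → ℝ}
    {S : Finset (ZdEdge d)} (hS : DependsOn Q (S : Set (ZdEdge d))) (hQm : Measurable Q) {C : ℝ}
    (hC : ∀ U, |Q U| ≤ C) {β' r : ℝ} (hβ' : 0 < β') (hβ'r : β' < r) (hr1 : r < betaOne d ρ) :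
    ∃ A : ℝ, ∀ β : ℝ, |β| ≤ β' → ∀ (Λ : Finset (Site d)) (z : Site d),
      |zdExpect ρ β Λ (fun U => Q U * Q (ZdGaugeConfig.translate z U)) -
          zdExpect ρ β Λ Q * zdExpect ρ β Λ (Q ∘ ZdGaugeConfig.translate z)| ≤
        A * Real.exp (-(Real.log (r / β') * ‖z‖)) := by
  have hr : 0 < r := hβ'.trans hβ'r
  set m : ℝ := Real.log (r / β') with hmdef
  have hm : 0 < m := Real.log_pos ((one_lt_div hβ').2 hβ'r)
  have hC0 : 0 ≤ C := (abs_nonneg _).trans (hC fun _ => 1)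
  -- the constants
  set c : ℕ := 2 * bondRadius S + 2 with hcdef
  set sB : ℕ := (S.card + S.card) * (2 ^ d * (d * d)) with hsB
  set κ : ℝ := 2 * Real.exp (1 / 2) with hκ
  have hκ1 : 1 ≤ κ := by
    rw [hκ]; have := Real.one_lt_exp_iff.2 (by norm_num : (0 : ℝ) < 1 / 2); linarith
  set K : ℝ := C * C * κ ^ sB + C * κ ^ sB * (C * κ ^ sB) with hK
  have hK0 : 0 ≤ K := by positivity
  refine ⟨K * Real.exp (m * c), fun β hββ' Λ z => ?_⟩
  have hR : (zdSystem (d := d) (G := G) ρ).Regular (costBound ρ) (Plaq.degBound d) :=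
    zdSystem_regular ρ hρ
  set X₀ : ℕ := supNorm z with hX₀
  have hzn : ‖z‖ = (X₀ : ℝ) := norm_eq_supNorm z
  -- the complexified observables and their supports
  set Φ₁ : ZdGaugeConfig d G → ℂ := fun U => (Q U : ℂ) with hΦ₁
  set Φ₂ : ZdGaugeConfig d G → ℂ := fun U => (Q (ZdGaugeConfig.translate z U) : ℂ) with hΦ₂
  set B₂ : Finset (ZdEdge d) := S.image fun e => (e.1 - -z, e.2) with hB₂
  have hΦ₁m : Measurable Φ₁ := Complex.measurable_ofReal.comp hQm
  have hΦ₂m : Measurable Φ₂ :=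
    Complex.measurable_ofReal.comp (hQm.comp (measurable_translate z))
  have hΦ₁b : ∀ U, ‖Φ₁ U‖ ≤ C := fun U => by
    rw [hΦ₁, Complex.norm_real, Real.norm_eq_abs]; exact hC _
  have hΦ₂b : ∀ U, ‖Φ₂ U‖ ≤ C := fun U => by
    rw [hΦ₂, Complex.norm_real, Real.norm_eq_abs]; exact hC _
  have hΦ₁d : DependsOn Φ₁ (S : Set (ZdEdge d)) := fun U V h => by
    show (Q U : ℂ) = Q V; rw [hS h]
  have hΦ₂d : DependsOn Φ₂ (B₂ : Set (ZdEdge d)) := by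
    intro U V h
    show (Q (ZdGaugeConfig.translate z U) : ℂ) = Q (ZdGaugeConfig.translate z V)
    have hU : Q (ZdGaugeConfig.translate z U) = Q (ZdGaugeConfig.translate z V) := by
      refine hS (fun e he => ?_)
      show U (e.1 + z, e.2) = V (e.1 + z, e.2)
      have hmem : ((e.1 - -z, e.2) : ZdEdge d) ∈ (B₂ : Set (ZdEdge d)) :=
        Finset.mem_coe.2 (Finset.mem_image_of_mem _ he)
      have := h _ hmem
      rwa [sub_neg_eq_add] at this
    rw [hU]
  -- step 1: the real truncated correlation is dominated by the complex one
  refine (abs_zdExpect_truncated_le_norm hρ β Λ hQm (hQm.comp (measurable_translate z)) hC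
    (fun U => hC (ZdGaugeConfig.translate z U))).trans ?_
  change ‖(zdSystem ρ).expect (fun U => Φ₁ U * Φ₂ U) (plaquettesIn Λ) β -
      (zdSystem ρ).expect Φ₁ (plaquettesIn Λ) β * (zdSystem ρ).expect Φ₂ (plaquettesIn Λ) β‖ ≤
    K * Real.exp (m * c) * Real.exp (-(m * ‖z‖))
  -- seed counts, uniformly in `z`
  have hs₁ : ((zdSystem (G := G) ρ).seedsOf S).card ≤ sB := by
    refine (card_seedsOf_zdSystem_le ρ S).trans ?_
    rw [hsB]; exact Nat.mul_le_mul_right _ (Nat.le_add_right _ _)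
  have hB₂c : B₂.card ≤ S.card := Finset.card_image_le
  have hs₂ : ((zdSystem (G := G) ρ).seedsOf B₂).card ≤ sB := by
    refine (card_seedsOf_zdSystem_le ρ B₂).trans ?_
    rw [hsB]; exact Nat.mul_le_mul_right _ (hB₂c.trans (Nat.le_add_left _ _))
  have hs₁₂ : ((zdSystem (G := G) ρ).seedsOf (S ∪ B₂)).card ≤ sB := by
    refine (card_seedsOf_zdSystem_le ρ _).trans ?_
    rw [hsB]
    exact Nat.mul_le_mul_right _ ((Finset.card_union_le _ _).trans (Nat.add_le_add_left hB₂c _))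
  have hKle : C * C * κ ^ ((zdSystem (G := G) ρ).seedsOf (S ∪ B₂)).card +
      C * κ ^ ((zdSystem (G := G) ρ).seedsOf S).card *
        (C * κ ^ ((zdSystem (G := G) ρ).seedsOf B₂).card) ≤ K := by
    rw [hK]
    refine add_le_add (mul_le_mul_of_nonneg_left (pow_le_pow_right₀ hκ1 hs₁₂) (by positivity))
      (mul_le_mul (mul_le_mul_of_nonneg_left (pow_le_pow_right₀ hκ1 hs₁) hC0)
        (mul_le_mul_of_nonneg_left (pow_le_pow_right₀ hκ1 hs₂) hC0) (by positivity)
        (by positivity))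
  -- the coupling in the closed disc `|β| ≤ β' < r` (negative couplings included)
  have hβn' : ‖(β : ℂ)‖ ≤ β' := by rw [Complex.norm_real, Real.norm_eq_abs]; exact hββ'
  have hβn : ‖(β : ℂ)‖ ≤ r := hβn'.trans hβ'r.le
  have hβR : ‖(β : ℂ)‖ ≤ PlaqSystem.betaR (costBound ρ) (Plaq.degBound d) := by
    rw [betaR_costBound]; exact hβn.trans hr1.le
  have hexp : Real.exp (m * c) * Real.exp (-(m * ‖z‖)) = Real.exp (m * c - m * X₀) := by
    rw [← Real.exp_add, hzn]; ring_nf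
  by_cases hfar : c < X₀
  · -- far displacements: disjoint supports, long joining polymers
    have hdisj : Disjoint S B₂ := disjoint_image_translate_of_lt (by rw [hcdef] at hfar; omega)
    have hn : ∀ P, P ⊆ plaquettesIn Λ → (zdSystem (G := G) ρ).Joins P S B₂ → X₀ - c ≤ P.card :=
      fun P _ hJ => le_card_of_joins_translate ρ hJ
    have hbound := PlaqSystem.norm_truncatedExpect_le hR hΦ₁m hΦ₂m hΦ₁b hΦ₂b hΦ₁d hΦ₂d hdisj
      (plaquettesIn Λ) hn hr (by rwa [betaR_costBound]) hβn
    refine hbound.trans ?_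
    -- the decay factor, uniformly on the disc: `(‖β‖/r)^n ≤ (β'/r)^n = e^{-m n}`
    have hdec : (‖(β : ℂ)‖ / r) ^ (X₀ - c) ≤ Real.exp (-(m * ((X₀ - c : ℕ) : ℝ))) := by
      have h1 : (‖(β : ℂ)‖ / r) ^ (X₀ - c) ≤ (β' / r) ^ (X₀ - c) :=
        pow_le_pow_left₀ (by positivity) (div_le_div_of_nonneg_right hβn' hr.le) _
      have h2 := pow_div_le_exp_neg hβ'.le hr (X₀ - c)
      rw [if_neg hβ'.ne', ← hmdef] at h2
      exact h1.trans h2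
    calc _ ≤ K * Real.exp (-(m * ((X₀ - c : ℕ) : ℝ))) :=
          mul_le_mul hKle hdec (by positivity) hK0
      _ = K * Real.exp (m * c) * Real.exp (-(m * ‖z‖)) := by
          rw [mul_assoc, hexp, Nat.cast_sub hfar.le]; ring_nf
  · -- near displacements: the crude bound
    have hfar' : X₀ ≤ c := not_lt.1 hfar
    have hbound := PlaqSystem.norm_truncatedExpect_le_const hR hβR hΦ₁m hΦ₂m hΦ₁b hΦ₂b hΦ₁d hΦ₂d
      (plaquettesIn Λ)
    refine (hbound.trans hKle).trans ?_
    rw [mul_assoc, hexp]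
    have h1 : (1 : ℝ) ≤ Real.exp (m * c - m * X₀) := by
      refine Real.one_le_exp ?_
      have : (X₀ : ℝ) ≤ c := by exact_mod_cast hfar'
      nlinarith
    nlinarith

/-! ### Infinite-volume limits at strong coupling, explicit radius -/

/-- **Infinite-volume limit and translation invariance at strong coupling, explicit radius**
(Osterwalder–Seiler 1978 Thms. 3.6–3.7 as proved in the tree, `exists_differentiableOn_tendsto_expect`,
with the radius `betaOne d ρ / 4` kept explicit, which the named fact `osterwalderSeiler_infiniteVolume`
hides): for a bounded measurable observable `F` supported on a finite bond set there is `g` with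
`⟨F⟩_{box L, β} → g β` and `⟨F ∘ τ_a⟩_{box L, β} → g β` for every `|β| < betaOne d ρ / 4` and
every `a`. [folklore] -/
theorem hasBoxLimit_zdExpect_of_dependsOn {d N : ℕ} {G : Type*} [Group G] [TopologicalSpace G]
    [IsTopologicalGroup G] [CompactSpace G] [MeasurableSpace G] [BorelSpace G]
    {ρ : G →* Matrix (Fin N) (Fin N) ℂ} (hρ : Continuous ρ) {F : ZdGaugeConfig d G → ℝ}
    {S : Finset (ZdEdge d)} (hS : DependsOn F (S : Set (ZdEdge d))) (hFm : Measurable F) {C : ℝ}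
    (hC : ∀ U, |F U| ≤ C) :
    ∃ g : ℝ → ℝ, ∀ β : ℝ, |β| < betaOne d ρ / 4 →
      HasBoxLimit (fun Λ => zdExpect ρ β Λ F) (g β) ∧
        ∀ a : Site d, HasBoxLimit (fun Λ => zdExpect ρ β Λ (F ∘ ZdGaugeConfig.translate a)) (g β) := by
  set Fc : ZdGaugeConfig d G → ℂ := fun U => (F U : ℂ) with hFc
  have hFcm : Measurable Fc := Complex.measurable_ofReal.comp hFm
  have hFcb : ∀ U, ‖Fc U‖ ≤ C := fun U => by
    simp only [hFc, Complex.norm_real, Real.norm_eq_abs]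
    exact hC U
  have hFcS : DependsOn Fc (S : Set (ZdEdge d)) := fun U V h => by simp only [hFc, hS h]
  obtain ⟨g, -, hglim⟩ := exists_differentiableOn_tendsto_expect hρ hFcm hFcb hFcS
  refine ⟨fun t => (g t).re, fun β hβ => ?_⟩
  have hβ' : ‖(β : ℂ)‖ < betaOne d ρ / 4 := by rwa [Complex.norm_real, Real.norm_eq_abs]
  have hconv := hglim β hβ'
  constructor
  · -- convergence along the boxes
    have hre : ∀ Λ, zdExpect ρ β Λ F = (expect ρ Fc Λ β).re := fun Λ => by
      rw [zdExpect_eq hρ β Λ hFm hC]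
      rfl
    have h1 : Tendsto (fun L : ℕ => expect ρ Fc (box d L) β) atTop (𝓝 (g β)) :=
      hconv.comp (Literature.MathematicalPhysics.QuantumFieldTheory.tendsto_box_atTop d)
    have h2 := (Complex.continuous_re.tendsto _).comp h1
    simp only [HasBoxLimit, hre]
    exact h2
  · -- translates: `⟨F ∘ τ_a⟩_Λ = ⟨F⟩_{Λ - a}` and translated boxes are cofinal
    intro a
    have hFam : Measurable (F ∘ ZdGaugeConfig.translate a) := hFm.comp (measurable_translate a)
    have hCa : ∀ U, |(F ∘ ZdGaugeConfig.translate a) U| ≤ C := fun U => hC _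
    have hre : ∀ Λ, zdExpect ρ β Λ (F ∘ ZdGaugeConfig.translate a) =
        (expect ρ Fc (Λ.image (· + -a)) β).re := fun Λ => by
      rw [zdExpect_eq hρ β Λ hFam hCa, ← expect_comp_translate hρ hFcm a Λ β]
      rfl
    have h1 : Tendsto (fun L : ℕ => expect ρ Fc ((box d L).image (· + -a)) β) atTop (𝓝 (g β)) :=
      hconv.comp (Literature.MathematicalPhysics.QuantumFieldTheory.tendsto_box_image_add_atTop d (-a))
    have h2 := (Complex.continuous_re.tendsto _).comp h1
    simp only [HasBoxLimit, hre]
    exact h2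

/-! ### The registered theorem -/

/-- **Brick F5 · `InfiniteVolumeCurvatureClustering`** (registered signature verbatim). For a
bounded measurable local observable `Q` of the `ℤ⁴`-gauge configurations and `0 < β' < betaOne 4 ρ / 4`
there are ONE mass `m > 0`, ONE constant `A` and the infinite-volume one- and two-point functions
`q β = lim_L ⟨Q ∘ τ_x⟩_{box L, β}` (independent of `x`) and
`P β (y − x) = lim_L ⟨(Q ∘ τ_x)(Q ∘ τ_y)⟩_{box L, β}` such that for all `0 ≤ β ≤ β'` the box
limits exist, are translation invariant, and cluster exponentially, β-uniformly:
`|P β z − q β ^ 2| ≤ A e^{−m ‖z‖_∞}` (Osterwalder–Seiler 1978 Thms. 3.5–3.7, free boundary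
conditions; here `m = log (betaOne 4 ρ / (2β'))`). [folklore] -/
theorem InfiniteVolumeCurvatureClustering : ∀ (N : ℕ) (G : Type) [Group G] [TopologicalSpace G] [IsTopologicalGroup G] [CompactSpace G] [T2Space G] [SecondCountableTopology G] [MeasurableSpace G] [BorelSpace G] (ρ : G →* Matrix (Fin N) (Fin N) ℂ), Continuous ρ → ∀ (Q : Literature.MathematicalPhysics.QuantumFieldTheory.ZdGaugeConfig 4 G → ℝ), Literature.MathematicalPhysics.QuantumFieldTheory.IsLocalObservable Q → Measurable Q → (∃ C : ℝ, ∀ U, |Q U| ≤ C) → ∀ β' : ℝ, 0 < β' → β' < betaOne 4 ρ / 4 → ∃ (m A : ℝ) (q : ℝ → ℝ) (P : ℝ → Literature.Probability.LatticeModels.Site 4 → ℝ), 0 < m ∧ ∀ β : ℝ, 0 ≤ β → β ≤ β' → (∀ x : Literature.Probability.LatticeModels.Site 4, Literature.Probability.LatticeModels.HasBoxLimit (fun Λ => Literature.MathematicalPhysics.QuantumFieldTheory.zdExpect ρ β Λ (Q ∘ Literature.MathematicalPhysics.QuantumFieldTheory.ZdGaugeConfig.translate x)) (q β)) ∧ (∀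 x y : Literature.Probability.LatticeModels.Site 4, Literature.Probability.LatticeModels.HasBoxLimit (fun Λ => Literature.MathematicalPhysics.QuantumFieldTheory.zdExpect ρ β Λ (fun U => Q (Literature.MathematicalPhysics.QuantumFieldTheory.ZdGaugeConfig.translate x U) * Q (Literature.MathematicalPhysics.QuantumFieldTheory.ZdGaugeConfig.translate y U))) (P β (y - x))) ∧ ∀ z : Literature.Probability.LatticeModels.Site 4, |P β z - q β ^ 2| ≤ A * Real.exp (-(m * ‖z‖)) := by
  intro N G _ _ _ _ _ _ _ _ ρ hρ Q hloc hQm hbdd β' hβ'0 hβ'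
  obtain ⟨S, hS⟩ := hloc
  obtain ⟨C, hC⟩ := hbdd
  have hb0 : 0 < betaOne 4 ρ := betaOne_pos 4
  -- the strong-coupling radius and the uniform finite-volume clustering
  have hβ'r : β' < betaOne 4 ρ / 2 := by linarith
  have hr1 : betaOne 4 ρ / 2 < betaOne 4 ρ := by linarith
  obtain ⟨A, hA⟩ := zdExpect_truncated_le_uniform hρ hS hQm hC hβ'0 hβ'r hr1
  -- the mass
  set m : ℝ := Real.log (betaOne 4 ρ / 2 / β') with hmdef
  have hm : 0 < m := Real.log_pos ((one_lt_div hβ'0).2 hβ'r)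
  -- the one-point limits
  obtain ⟨gQ, hgQ⟩ := hasBoxLimit_zdExpect_of_dependsOn hρ hS hQm hC
  -- the two-point limits
  have hpair : ∀ z : Site 4, ∃ g : ℝ → ℝ, ∀ β : ℝ, |β| < betaOne 4 ρ / 4 →
      HasBoxLimit (fun Λ => zdExpect ρ β Λ (fun U => Q U * Q (ZdGaugeConfig.translate z U))) (g β) ∧
        ∀ a : Site 4, HasBoxLimit (fun Λ => zdExpect ρ β Λ
          ((fun U => Q U * Q (ZdGaugeConfig.translate z U)) ∘ ZdGaugeConfig.translate a)) (g β) := by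
    intro z
    refine hasBoxLimit_zdExpect_of_dependsOn hρ (S := S ∪ S.image fun e => (e.1 - -z, e.2)) ?_
      (hQm.mul (hQm.comp (measurable_translate z))) (C := C * C) ?_
    · intro U V h
      simp only [Finset.coe_union] at h
      show Q U * Q (ZdGaugeConfig.translate z U) = Q V * Q (ZdGaugeConfig.translate z V)
      have hU : Q U = Q V := hS (fun e he => h e (Or.inl he))
      have hU' : Q (ZdGaugeConfig.translate z U) = Q (ZdGaugeConfig.translate z V) := by
        refine hS (fun e he => ?_)
        show U (e.1 + z, e.2) = V (e.1 + z, e.2)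
        have hmem : ((e.1 - -z, e.2) : ZdEdge 4) ∈
            ((S.image fun e => (e.1 - -z, e.2) : Finset (ZdEdge 4)) : Set (ZdEdge 4)) :=
          Finset.mem_coe.2 (Finset.mem_image_of_mem _ he)
        have := h _ (Or.inr hmem)
        rwa [sub_neg_eq_add] at this
      rw [hU, hU']
    · intro U
      rw [abs_mul]
      exact mul_le_mul (hC _) (hC _) (abs_nonneg _) ((abs_nonneg _).trans (hC U))
  choose gP hgP using hpair
  refine ⟨m, A, gQ, fun β z => gP z β, hm, fun β hβ0 hββ' => ?_⟩
  have hβlt : |β| < betaOne 4 ρ / 4 := by rw [abs_of_nonneg hβ0]; exact lt_of_le_of_lt hββ' hβ'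
  have hβle : |β| ≤ β' := by rw [abs_of_nonneg hβ0]; exact hββ'
  refine ⟨fun x => (hgQ β hβlt).2 x, fun x y => ?_, fun z => ?_⟩
  · -- the pair observable is a translate of `Q · (Q ∘ τ_{y-x})`
    have hfun : (fun U : ZdGaugeConfig 4 G =>
        Q (ZdGaugeConfig.translate x U) * Q (ZdGaugeConfig.translate y U)) =
        (fun U => Q U * Q (ZdGaugeConfig.translate (y - x) U)) ∘ ZdGaugeConfig.translate x := by
      funext U
      simp only [Function.comp_apply]
      congr 2
      funext e
      simp only [ZdGaugeConfig.translate]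
      rw [add_assoc, sub_add_cancel]
    rw [hfun]
    exact (hgP (y - x) β hβlt).2 x
  · -- clustering passes to the limit
    have h1 : Tendsto (fun L : ℕ => zdExpect ρ β (box 4 L)
        (fun U => Q U * Q (ZdGaugeConfig.translate z U))) atTop (𝓝 (gP z β)) := (hgP z β hβlt).1
    have h2 : Tendsto (fun L : ℕ => zdExpect ρ β (box 4 L) Q) atTop (𝓝 (gQ β)) := (hgQ β hβlt).1
    have h3 : Tendsto (fun L : ℕ => zdExpect ρ β (box 4 L) (Q ∘ ZdGaugeConfig.translate z)) atTop
        (𝓝 (gQ β)) := (hgQ β hβlt).2 z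
    have h4 := (h1.sub (h2.mul h3)).abs
    have h5 : |gP z β - gQ β * gQ β| ≤ A * Real.exp (-(m * ‖z‖)) :=
      le_of_tendsto' h4 fun L => hA β hβle (box 4 L) z
    rwa [← pow_two] at h5

end Summit.QuantumFields.YangMills.Theorems.CurvatureKernel

end
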